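import Summits.BirchSwinnertonDyer.BirchSwinnertonDyer.Theses.PlecticLegs

/-!
# Route PlecticLegs — assembly item `Assembly`

`Assembly := PlecticPointsLB → PlecticRankUB → TwistSupply → ArtinBaseChange → KatoDescent →
RankLeOne → BirchSwinnertonDyer` is literally the type of the route's certified deciding theorem
`closes` (route file `Theses/PlecticLegs.lean`, rev 1); this file closes the assembly item
stmt-BirchSwinnertonDyer-18263 by that theorem.

Nothing else is here: the glue (case split on `r_an(E) ≤ 1`, handled by `RankLeOne`; otherwise
`TwistSupply` supplies `m` and `H ≤ Gal(ℚ(ζ_m)/ℚ)` with totally real fixed field `F` of degree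
`r_an(E)` and all non-trivial twists non-vanishing at `s = 1`, `ArtinBaseChange` gives
`r_an(E_F) = r_an(E) = [F:ℚ]`, `PlecticPointsLB`/`PlecticRankUB` give `rank E(F) = [F:ℚ]`, and
`KatoDescent` gives `rank E(ℚ) = rank E(F)`; `omega` closes the arithmetic) lives in `closes`
itself, which is sorry-free with the standard axioms.
-/

-- D-0017: single-problem summit, so `Summit.BirchSwinnertonDyer.BirchSwinnertonDyer.…` repeats a
-- namespace BY DESIGN.
set_option linter.dupNamespace false

namespace Summit.BirchSwinnertonDyer.BirchSwinnertonDyer.Theorems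

/-- The assembly item of route PlecticLegs (stmt-BirchSwinnertonDyer-18263): the cruxes
`PlecticPointsLB` (rank `≥ [F:ℚ]` in the plectic regime over a totally real `F` of degree `≥ 2`),
`PlecticRankUB` (rank `≤ [F:ℚ]` there), `TwistSupply` (a totally real abelian "silent" field of
degree `r_an(E)` for every `E/ℚ` with `r_an(E) ≥ 2`) and the supports `ArtinBaseChange`
(`r_an(E_F) = r_an(E)`), `KatoDescent` (`rank E(F) = rank E(ℚ)`) and `RankLeOne` (the known cases
`r_an ≤ 1`) imply `BirchSwinnertonDyer`. This is the type of the route's deciding theorem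
`Summit.BirchSwinnertonDyer.BirchSwinnertonDyer.Theses.PlecticLegs.closes`, so the proof is that
theorem. -/
theorem plecticLegs_assembly_proof :
    Summit.BirchSwinnertonDyer.BirchSwinnertonDyer.Theses.PlecticLegs.Assembly := by
  unfold Summit.BirchSwinnertonDyer.BirchSwinnertonDyer.Theses.PlecticLegs.Assembly
  exact Summit.BirchSwinnertonDyer.BirchSwinnertonDyer.Theses.PlecticLegs.closes

end Summit.BirchSwinnertonDyer.BirchSwinnertonDyer.Theorems
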